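import Summits.ValiantsHypothesis.ValiantsHypothesis.Theorems.ProofCarryingSymmetryAssembly
import Summits.ValiantsHypothesis.ValiantsHypothesis.Theorems.ProofCarryingSymmetrySquareSymmetricPermLB
import Summits.ValiantsHypothesis.ValiantsHypothesis.Theorems.ProofCarryingSymmetryRestorationQPLineGlue
import Summits.ValiantsHypothesis.ValiantsHypothesis.Theorems.ProofCarryingSymmetryRestorationQPPolylogWidth
import Literature.Computability.AlgebraicComplexity.ValiantConjectureEquivProofs

/-!
# Crux `RestorationQP` (route ProofCarryingSymmetry) — strategy census s5: Lean certificates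

Crux-strategist seat `cstrat-stmt-ValiantsHypothesis-10343-s5` (second independent strategy census).
This file is EVIDENCE for `STRATEGY-CENSUS-s5.md`; it proves nothing new about the crux.  It certifies,
against the tree as it stands (anchor `squareSymmetricPermLB_proof`, assembly lemmas, hub), the three
facts the census leans on:

* `restorationPer_iff_valiantsHypothesis` — the WEAKEST statement that can replace `RestorationQP` in
  `closes` while still feeding the anchor `SquareSymmetricPermLB`, namely the per-slice
  `RestorationPer` ("per ∈ VP ⇒ quasi-polynomial S_n-symmetric circuits for per_n"), is EQUIVALENT to the
  summit `ValiantsHypothesis` given tree theorems (⇒: anchor + `(log n + c)^c < εn`; ⇐: vacuously, since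
  `VP ≠ VNP ⇒ per ∉ VP` by VNP-completeness, `perFamily_mem_VP_iff_VP_eq_VNP`).  Hence every
  "weaker intermediate" X with `RestorationQP → X → RestorationPer` already implies the summit
  (`valiantsHypothesis_of_between`): along the anchor there is no statement strictly between the crux and S.
* `valiantsHypothesis_of_T'_of_S2` — the best typed decomposition {T′, S2⁗} of the lead's registered line
  (glue `restorationQP_of_invarianceProvableQP'_of_proofsToDistEquiv`, p163213) feeds the summit, and
  GIVEN the bet S2⁗ the piece T′ is equivalent to the crux (`restorationQP_iff_…`, tree), so the split
  relocates the whole crux into T′ modulo the bet.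
* `valiantsHypothesis_of_widthLawVP'` — the strictly-weaker consequence WidthLawVP of the crux still
  implies S (tree `valiantsHypothesis_of_widthLawVP`, p166528): weaker-than-crux, not weaker-than-summit.

Everything here is a few lines of logic over landed theorems; no `sorry`, no new named facts.
-/

-- single-problem summit: `Summit.ValiantsHypothesis.ValiantsHypothesis.…` is the namespace by design (D-0017)
set_option linter.dupNamespace false

namespace Summit.ValiantsHypothesis.ValiantsHypothesis.Cruxes.RestorationQP.CensusS5

open Literature.Computability.AlgebraicComplexity
open Summit.ValiantsHypothesis.ValiantsHypothesis.Theses.ProofCarryingSymmetry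

/-- The PER-SLICE of the crux: the instance of `RestorationQP` at the one family the anchor speaks
about.  `closes` consumes `RestorationQP` only through this slice (see `Assembly_proof`). [folklore] -/
def RestorationPer : Prop :=
  IsVPFamily (fun n => perPoly (Fin n) ℂ) →
    ∃ c : ℕ, ∀ n : ℕ, ∃ (G : Type) (_ : Fintype G)
      (C : LabelledArithCircuit ℂ (Fin n × Fin n) Unit G),
      C.IsSymmetric (Equiv.Perm (Fin n)) ∧ C.eval (C.output ()) = perPoly (Fin n) ℂ ∧
        Fintype.card G ≤ 2 ^ ((Nat.log 2 n + c) ^ c)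

/-- The crux implies its per-slice (per_n is diagonally invariant, `rename_smul_perPoly`). [folklore] -/
theorem restorationPer_of_restorationQP (hR : RestorationQP) : RestorationPer := fun hVP =>
  hR (fun n => perPoly (Fin n) ℂ)
    (fun n σ => Summit.ValiantsHypothesis.Theorems.ProofCarryingSymmetry.rename_smul_perPoly n σ) hVP

/-- The per-slice alone gives the summit: the anchor `SquareSymmetricPermLB` is a THEOREM
(`squareSymmetricPermLB_proof`, Dawar–Wilsenach 2025 Thm 7.1), and quasi-polynomial is `2^{o(n)}`
(`natLog_add_pow_lt_mul_eventually`); the rest is the hub lemma, verbatim as in `Assembly_proof`. [folklore] -/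
theorem valiantsHypothesis_of_restorationPer (hR : RestorationPer) : _root_.ValiantsHypothesis := by
  refine Summit.ValiantsHypothesis.Hub.valiantsHypothesis_of_not_isVPFamily_per ?_
    (mem_VP_ofFintype_iff_holds _) (perFamily_mem_VNP_holds ℂ)
  intro hVP
  obtain ⟨c, hc⟩ := hR hVP
  choose G hG C hsym heval hcard using hc
  obtain ⟨ε, hε, hio⟩ :=
    @Summit.ValiantsHypothesis.ValiantsHypothesis.Theorems.squareSymmetricPermLB_proof G hG C hsym heval
  obtain ⟨n₀, hn₀⟩ :=
    Summit.ValiantsHypothesis.Theorems.ProofCarryingSymmetry.natLog_add_pow_lt_mul_eventually c hε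
  obtain ⟨n, hn, hle⟩ := hio n₀
  have h1 : (Fintype.card (G n) : ℝ) ≤ (2 : ℝ) ^ (((Nat.log 2 n + c) ^ c : ℕ) : ℝ) := by
    rw [Real.rpow_natCast]
    exact_mod_cast hcard n
  have h2 : ε * n ≤ (((Nat.log 2 n + c) ^ c : ℕ) : ℝ) :=
    (Real.rpow_le_rpow_left_iff one_lt_two).1 (hle.trans h1)
  exact absurd (hn₀ n hn) (not_lt.2 h2)

/-- The summit makes the per-slice VACUOUS: `VP ℂ ≠ VNP ℂ ⇒ per ∉ VP` (VNP-completeness of per in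
characteristic ≠ 2, `perFamily_mem_VP_iff_VP_eq_VNP`; bundling bridge `mem_VP_ofFintype_iff_holds`). [folklore] -/
theorem not_isVPFamily_per_of_valiantsHypothesis (hVH : _root_.ValiantsHypothesis) :
    ¬ IsVPFamily (fun n => perPoly (Fin n) ℂ) := by
  intro hVP
  have hne : VP ℂ ≠ VNP ℂ := hVH
  exact hne ((perFamily_mem_VP_iff_VP_eq_VNP ℂ ringChar_complex_ne_two).1
    ((mem_VP_ofFintype_iff_holds _).2 hVP))

/-- Hence `ValiantsHypothesis → RestorationPer` (ex falso on the hypothesis `per ∈ VP`). [folklore] -/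
theorem restorationPer_of_valiantsHypothesis (hVH : _root_.ValiantsHypothesis) : RestorationPer :=
  fun hVP => absurd hVP (not_isVPFamily_per_of_valiantsHypothesis hVH)

/-- **The per-slice of the crux IS the summit** (given tree theorems): `RestorationPer ↔ ValiantsHypothesis`.
This is the certificate behind the census heading "weaker intermediate": the anchor consumes exactly
summit strength, so no replacement crux lying between `RestorationQP` and its per-slice is short of S. [folklore] -/
theorem restorationPer_iff_valiantsHypothesis : RestorationPer ↔ _root_.ValiantsHypothesis :=
  ⟨valiantsHypothesis_of_restorationPer, restorationPer_of_valiantsHypothesis⟩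

/-- Sandwich corollary: ANY statement `X` that still feeds the anchor (i.e. `X → RestorationPer`)
implies the summit outright. [folklore] -/
theorem valiantsHypothesis_of_between {X : Prop} (hX : X → RestorationPer) (h : X) :
    _root_.ValiantsHypothesis :=
  valiantsHypothesis_of_restorationPer (hX h)

/-- The crux itself through the slice (re-derivation of the route's `closes` with the anchor discharged):
`RestorationQP → ValiantsHypothesis` unconditionally. [folklore] -/
theorem valiantsHypothesis_of_restorationQP (hR : RestorationQP) : _root_.ValiantsHypothesis :=
  valiantsHypothesis_of_between restorationPer_of_restorationQP hR

/-- DECOMPOSITION certificate: the registered line's two open stubs T′ (generic quasi-polynomial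
proof-carrying circuits) and S2⁗ (distributivity elimination at polynomial cost, the bet ≡ L), with the
landed glue `restorationQP_of_invarianceProvableQP'_of_proofsToDistEquiv` (p163213), feed the summit;
statements verbatim the registered signatures. [folklore] -/
theorem valiantsHypothesis_of_T'_of_S2
    (hT : ∀ f : (n : ℕ) → MvPolynomial (Fin n × Fin n) ℂ,
      (∀ (n : ℕ) (σ : Equiv.Perm (Fin n)),
        MvPolynomial.rename (fun x : Fin n × Fin n => σ • x) (f n) = f n) →
      (∃ c : ℕ, ∀ n : ℕ, (f n).totalDegree ≤ (n + 2) ^ c ∧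
        ∃ C : PICircuit ℂ (Fin n × Fin n), C.eval = f n ∧ C.size ≤ (n + 2) ^ c) →
      ∃ c : ℕ, ∀ n : ℕ, ∃ C : PICircuit ℂ (Fin n × Fin n),
        C.eval = f n ∧ C.size ≤ 2 ^ ((Nat.log 2 n + c) ^ c) ∧
        ∀ σ : Equiv.Perm (Fin n),
          HasPCProofOfSize (C.rename fun x : Fin n × Fin n => σ • x) C
            (2 ^ ((Nat.log 2 n + c) ^ c)))
    (hS2 : ∃ c : ℕ, ∀ (n t : ℕ) (C : PICircuit ℂ (Fin n × Fin n)),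
      (∀ σ : Equiv.Perm (Fin n),
        HasPCProofOfSize (C.rename fun x : Fin n × Fin n => σ • x) C t) →
      ∃ C' : PICircuit ℂ (Fin n × Fin n), C'.eval = C.eval ∧
        C'.size ≤ (C.size + t + n + 2) ^ c ∧
        ∀ σ : Equiv.Perm (Fin n),
          (pfSystem ℂ (Fin n × Fin n)).Provable (C'.rename fun x : Fin n × Fin n => σ • x).unfold
            C'.unfold ⊤ (fun s => if s = PIAxiom.A6 then 0 else ⊤)) :
    _root_.ValiantsHypothesis :=
  valiantsHypothesis_of_restorationQP
    (Summit.ValiantsHypothesis.ValiantsHypothesis.Theorems.restorationQP_of_invarianceProvableQP'_of_proofsToDistEquiv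
      hT hS2)

/-- … and GIVEN the bet S2⁗ the piece T′ is not weaker than the crux: `S2⁗ → (T′ ↔ RestorationQP)`
(tree `restorationQP_iff_invarianceProvableQP'_of_proofsToDistEquiv`, necessity p157625).  So the split
{T′, S2⁗} passes "no piece gives S alone" only formally: modulo the route's own bet, T′ ≡ crux. [folklore] -/
theorem T'_iff_restorationQP_of_S2
    (hS2 : ∃ c : ℕ, ∀ (n t : ℕ) (C : PICircuit ℂ (Fin n × Fin n)),
      (∀ σ : Equiv.Perm (Fin n),
        HasPCProofOfSize (C.rename fun x : Fin n × Fin n => σ • x) C t) →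
      ∃ C' : PICircuit ℂ (Fin n × Fin n), C'.eval = C.eval ∧
        C'.size ≤ (C.size + t + n + 2) ^ c ∧
        ∀ σ : Equiv.Perm (Fin n),
          (pfSystem ℂ (Fin n × Fin n)).Provable (C'.rename fun x : Fin n × Fin n => σ • x).unfold
            C'.unfold ⊤ (fun s => if s = PIAxiom.A6 then 0 else ⊤)) :
    (∀ f : (n : ℕ) → MvPolynomial (Fin n × Fin n) ℂ,
      (∀ (n : ℕ) (σ : Equiv.Perm (Fin n)),
        MvPolynomial.rename (fun x : Fin n × Fin n => σ • x) (f n) = f n) →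
      (∃ c : ℕ, ∀ n : ℕ, (f n).totalDegree ≤ (n + 2) ^ c ∧
        ∃ C : PICircuit ℂ (Fin n × Fin n), C.eval = f n ∧ C.size ≤ (n + 2) ^ c) →
      ∃ c : ℕ, ∀ n : ℕ, ∃ C : PICircuit ℂ (Fin n × Fin n),
        C.eval = f n ∧ C.size ≤ 2 ^ ((Nat.log 2 n + c) ^ c) ∧
        ∀ σ : Equiv.Perm (Fin n),
          HasPCProofOfSize (C.rename fun x : Fin n × Fin n => σ • x) C
            (2 ^ ((Nat.log 2 n + c) ^ c))) ↔ RestorationQP :=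
  (Summit.ValiantsHypothesis.ValiantsHypothesis.Theorems.restorationQP_iff_invarianceProvableQP'_of_proofsToDistEquiv
    hS2).symm

/-- WEAKER-THAN-CRUX IS NOT WEAKER-THAN-SUMMIT: the polylog width law for invariant VP families (a strict
consequence of the crux, `widthLawVP_of_restorationQP`) already implies S (tree
`valiantsHypothesis_of_widthLawVP`, p166528). Restated here by name only. [folklore] -/
theorem valiantsHypothesis_of_widthLawVP'
    (hW : ∀ f : (n : ℕ) → MvPolynomial (Fin n × Fin n) ℂ,
      (∀ (n : ℕ) (σ : Equiv.Perm (Fin n)),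
        MvPolynomial.rename (fun x : Fin n × Fin n => σ • x) (f n) = f n) →
      IsVPFamily f →
      ∃ c : ℕ, ∀ (n : ℕ) (X Y : SimpleGraph (Fin n)),
        Literature.ModelTheory.FiniteModelTheory.CkEquiv ((Nat.log 2 n + c) ^ c) X Y →
        MvPolynomial.eval (Set.indicator {ij : Fin n × Fin n | X.Adj ij.1 ij.2} 1) (f n) =
          MvPolynomial.eval (Set.indicator {ij : Fin n × Fin n | Y.Adj ij.1 ij.2} 1) (f n)) :
    _root_.ValiantsHypothesis :=
  Summit.ValiantsHypothesis.ValiantsHypothesis.Theorems.valiantsHypothesis_of_widthLawVP hW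

/-! ### Transfer heading — where the two solved siblings' arguments break (toy certificates)

(α) ENTRY-SYMMETRIC sibling (full `S_{n²}` permuting all matrix entries; restoration is a THEOREM there:
tree `qpSymmetric_of_entrySymmetric` from the named fact `BlaserJindal2019_thm4` + ζ-G
`zeta_symmetric_esymm`).  Its engine is the fundamental theorem of symmetric polynomials + Newton
inversion of `x ↦ (e_1(x), …, e_N(x))`, available exactly when the group is generated by
pseudoreflections (Chevalley–Shephard–Todd).  For the DIAGONAL action no non-identity element is a
pseudoreflection: a transposition already moves `2n − 2` two-cycles of coordinates (`8` of the `9`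
coordinates at `n = 3`, only `(2,2)` fixed), so its fixed space has codimension `2n − 2 ≥ 2`.

(β) DETERMINANT sibling (`DetCalibration`, proved: Le Verrier = power sums of eigenvalues + Newton
identities, i.e. `det ∈ ℂ[tr X, tr X², …]`, the conjugation invariants).  The permanent is not a
conjugation invariant already at `n = 2`, so no trace/Newton expression exists for it. -/

/-- (α) at `n = 3`: the diagonal transposition `(0 1)` fixes only the coordinate `(2,2)` of the `3 × 3`
variable matrix — it moves 8 coordinates (four 2-cycles), so it is not a pseudoreflection. [folklore] -/
example : (Finset.univ.filter fun x : Fin 3 × Fin 3 =>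
    (Equiv.swap (0 : Fin 3) 1 x.1, Equiv.swap (0 : Fin 3) 1 x.2) ≠ x).card = 8 := by decide

/-- (β): `per` is not invariant under conjugation `X ↦ g X g⁻¹`: with `X = !![0,1;1,0]` (per = 1) and
`g = !![1,1;0,1]`, `g X g⁻¹ = !![1,0;1,-1]` has permanent `-1`. [folklore] -/
example : (!![1, 1; 0, 1] : Matrix (Fin 2) (Fin 2) ℤ) * !![0, 1; 1, 0] * !![1, -1; 0, 1] = !![1, 0; 1, -1] := by
  decide

example : Matrix.permanent (!![0, 1; 1, 0] : Matrix (Fin 2) (Fin 2) ℤ) = 1 ∧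
    Matrix.permanent (!![1, 0; 1, -1] : Matrix (Fin 2) (Fin 2) ℤ) = -1 := by
  constructor <;> simp [Matrix.permanent] <;> decide

end Summit.ValiantsHypothesis.ValiantsHypothesis.Cruxes.RestorationQP.CensusS5
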